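import Mathlib
import Summits.MatrixMultiplication.Statement
import Summits.MatrixMultiplication.MatrixMultiplication.Theses.SemilatticeSTPP

/-!
# Crux `Thesis` (stmt-MatrixMultiplication-5969) — BC3 birth skeleton `Lines/birthSemilatticeSTPP.lean`, route `SemilatticeSTPP`

(Path note: the crux work-dir `Cruxes/Thesis/` is keyed by the short decl name `Thesis` and is SHARED with
item stmt-MatrixMultiplication-7270 = `NOFWindowCapacity.Thesis`, whose registrar already holds
`Lines/birth.lean` + `Lines/birth.md` there (2026-08-17T02:34Z).  To avoid overwriting another crux's
registered skeleton this file is published as `Lines/birthSemilatticeSTPP.lean` (+ `.md`), in its own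
namespace `…Cruxes.Thesis.BirthSemilatticeSTPP`; it is the `Lines/birth.lean` of item 5969 in all but name.)

Route `SemilatticeSTPP` (route-MatrixMultiplication-SemilatticeSTPP; re-audit bin HONEST-BET-1LEAF: the
deciding theorem `closes : TPPRestriction → RegularMonoidRank → Thesis → MatrixMultiplication` has both
supports proved, so `Thesis` = X_M is the route's one open load-bearing leaf).

The crux, verbatim (`Summit.MatrixMultiplication.MatrixMultiplication.Theses.SemilatticeSTPP.Thesis`):
for every `ε > 0` a finite commutative monoid `M` with every element regular (`x = x*y*x`), and a
MONOID-TPP family `α β γ` (the iff-form, indexed exactly like `matMulDirectSum`) with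
`|M| < Σ_i (a_i b_i c_i)^((2+ε)/3)`.

THE LINE = the route header's own foreseen two-layer split of the idempotent branch
("IdempotentPacking ⇐ UnionClosedHost (packings whose images generate a union-closed family of size
< Σ (abc)^((2+ε)/3)) → IdempotentPacking (the x ↦ non-upper-bounds embedding makes these equivalent)",
TWO-LAYER PLAN) composed with the proved-in-Sketch step `IdempotentPacking → Thesis` (an idempotent is
regular with `y := x`), typed:

* `stub_unionClosedDesign` (XL, OPEN — the load-bearing bet, a TRANSFER of the idempotent part of X_M to
  extremal set theory): for every `ε > 0` a monoid-TPP family of finite SETS `α β γ ⊆ Fin m` under UNION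
  (exactly the data quantified in the route's crux `BooleanObstruction`) together with a union-closed family
  `F ∋ ∅` containing every `α x, β y, γ z`, of size `|F| < Σ_i (a_i b_i c_i)^((2+ε)/3)`.  Why easier than
  the crux as filed: the host is no longer an abstract monoid but the union-closure of the design, a
  finite set system in `2^[m]` — small cases are SAT/ILP-searchable and kernel-checkable by `decide`, the
  size of a generated union-closed family is the object of Frankl / Kleitman / Ahlswede–Daykin-type
  extremal set theory, and the per-block structure (core `K_i` + Bollobás / Sperner set-pair systems,
  refuter note on item 5969) is native there.  It is NOT `¬BooleanObstruction` (host size `|F|`, not `2^m`)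
  and it is equivalent to the route's rank-4 crux `IdempotentPacking` (every finite semilattice is a
  union-closed family of the same size via its non-upper-bounds `x ↦ {y | ¬ x ≤ y}`, `x ≤ y :↔ x*y = y`,
  a ∪-homomorphic injection with `1 ↦ ∅`), so a proof of item stmt-MatrixMultiplication-5972 yields it
  through that embedding, and conversely (`IdempotentPacking_of` below).
* `stub_hostFromFamily` (S/M, PROVABLE NOW): a union-closed family `F` of finsets with `∅ ∈ F` IS a finite
  commutative idempotent monoid of order `|F|` (the subtype `↥F` under `∪`, identity `∅`), and maps into
  `F` become maps into that monoid reproducing the union relation `α x ∪ β y = γ z` on the nose.  This is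
  the (easy) direction of that equivalence which the composition needs.

`Thesis_of_sigs : stub₁-sig → stub₂-sig → (body of Thesis)` is the sorry-free composition with EXPLICIT
hypotheses (host from the family; regular witness `y := x` from idempotency; the TPP iff transported along
`hrel`; `|M| = |F|`), and `Thesis_of : Thesis := Thesis_of_sigs stub_unionClosedDesign stub_hostFromFamily`
concludes the crux BY NAME from the declared stubs (`closed = false` only through `stub_*`; it is the unique
by-name candidate, as `#h21_check_skeleton` admits only by-name obligations as hypotheses of that theorem);
`IdempotentPacking_of_sigs` / `IdempotentPacking_of` record that the same two stubs give the rank-4 crux.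

Disproof used: no `Disproof.lean`, no `_false_without_` theorem and no landed `Negative/` lemma exist for
this crux (`ledger crux ls stmt-MatrixMultiplication-5969`, 2026-08-17 — the shared dir `Cruxes/Thesis`
holds only route NOFWindowCapacity's files for item 7270); `ledger negatives --problem
MatrixMultiplication` has nothing on semilattice / union-closed / monoid hosts.  In-route refuting
drivers: `¬IdempotentVolumeBeat` (V ≤ |L| for every finite semilattice) kills `stub_unionClosedDesign`
(ε := 1 already needs a volume beat); `BooleanObstruction` does NOT (it bounds by `2^m`, not `|F|`).
-/

set_option linter.dupNamespace false

namespace Summit.MatrixMultiplication.MatrixMultiplication.Cruxes.Thesis.BirthSemilatticeSTPP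

open Summit.MatrixMultiplication.MatrixMultiplication.Theses.SemilatticeSTPP

/-- STUB 1 — the union-closed design (the open bet; transfer of the idempotent part of X_M to set systems):
for every `ε > 0` there are `m`, shapes `a b c : Fin p → ℕ`, set-valued coordinate maps `α β γ` into
`Finset (Fin m)` satisfying the monoid-TPP iff with UNION as the product, and a union-closed family `F`
with `∅ ∈ F` containing all their values, of size `|F| < Σ_i (a_i b_i c_i)^((2+ε)/3)`. -/
theorem stub_unionClosedDesign :
    ∀ ε : ℝ, 0 < ε → ∃ (m p : ℕ) (a b c : Fin p → ℕ)
      (α : (Σ i, Fin (a i) × Fin (b i)) → Finset (Fin m))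
      (β : (Σ i, Fin (b i) × Fin (c i)) → Finset (Fin m))
      (γ : (Σ i, Fin (a i) × Fin (c i)) → Finset (Fin m))
      (F : Finset (Finset (Fin m))),
      (∀ x y z, α x ∪ β y = γ z ↔
        (z.1 = x.1 ∧ x.1 = y.1 ∧ (z.2.1 : ℕ) = x.2.1 ∧ (x.2.2 : ℕ) = y.2.1 ∧ (z.2.2 : ℕ) = y.2.2)) ∧
      (∅ : Finset (Fin m)) ∈ F ∧ (∀ A ∈ F, ∀ B ∈ F, A ∪ B ∈ F) ∧
      (∀ x, α x ∈ F) ∧ (∀ y, β y ∈ F) ∧ (∀ z, γ z ∈ F) ∧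
      (F.card : ℝ) < ∑ i, ((a i * b i * c i : ℕ) : ℝ) ^ ((2 + ε) / 3) := by
  sorry

/-- STUB 2 — host from family (provable now): a union-closed family `F` of finsets with `∅ ∈ F` is a
finite commutative IDEMPOTENT monoid of order exactly `|F|`, and set-valued maps `α β γ` with values in `F`
lift to maps into that monoid on which the product relation `α' x * β' y = γ' z` is literally the union
relation `α x ∪ β y = γ z`. -/
theorem stub_hostFromFamily :
    ∀ (m p : ℕ) (a b c : Fin p → ℕ)
      (α : (Σ i, Fin (a i) × Fin (b i)) → Finset (Fin m))
      (β : (Σ i, Fin (b i) × Fin (c i)) → Finset (Fin m))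
      (γ : (Σ i, Fin (a i) × Fin (c i)) → Finset (Fin m))
      (F : Finset (Finset (Fin m))),
      (∅ : Finset (Fin m)) ∈ F → (∀ A ∈ F, ∀ B ∈ F, A ∪ B ∈ F) →
      (∀ x, α x ∈ F) → (∀ y, β y ∈ F) → (∀ z, γ z ∈ F) →
      ∃ (M : Type) (_ : CommMonoid M) (_ : Fintype M)
        (α' : (Σ i, Fin (a i) × Fin (b i)) → M)
        (β' : (Σ i, Fin (b i) × Fin (c i)) → M)
        (γ' : (Σ i, Fin (a i) × Fin (c i)) → M),
        (∀ x : M, x * x = x) ∧ Fintype.card M = F.card ∧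
        (∀ x y z, α' x * β' y = γ' z ↔ α x ∪ β y = γ z) := by
  sorry

/-- BC3 SHAPE `stub₁-sig → stub₂-sig → (rank-4 crux)`, explicit hypotheses, conclusion = the body of the
route's rank-4 crux `IdempotentPacking` (stmt-MatrixMultiplication-5972) VERBATIM (so that this theorem is not
itself a by-name candidate of the skeleton audit); real proof, no `sorry`: host from the family, idempotency
from the stub, the TPP iff transported along the union relation, `|M| = |F|`. -/
theorem IdempotentPacking_of_sigs
    (hD : (∀ ε : ℝ, 0 < ε → ∃ (m p : ℕ) (a b c : Fin p → ℕ)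
      (α : (Σ i, Fin (a i) × Fin (b i)) → Finset (Fin m))
      (β : (Σ i, Fin (b i) × Fin (c i)) → Finset (Fin m))
      (γ : (Σ i, Fin (a i) × Fin (c i)) → Finset (Fin m))
      (F : Finset (Finset (Fin m))),
      (∀ x y z, α x ∪ β y = γ z ↔
        (z.1 = x.1 ∧ x.1 = y.1 ∧ (z.2.1 : ℕ) = x.2.1 ∧ (x.2.2 : ℕ) = y.2.1 ∧ (z.2.2 : ℕ) = y.2.2)) ∧
      (∅ : Finset (Fin m)) ∈ F ∧ (∀ A ∈ F, ∀ B ∈ F, A ∪ B ∈ F) ∧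
      (∀ x, α x ∈ F) ∧ (∀ y, β y ∈ F) ∧ (∀ z, γ z ∈ F) ∧
      (F.card : ℝ) < ∑ i, ((a i * b i * c i : ℕ) : ℝ) ^ ((2 + ε) / 3)))
    (hH : (∀ (m p : ℕ) (a b c : Fin p → ℕ)
      (α : (Σ i, Fin (a i) × Fin (b i)) → Finset (Fin m))
      (β : (Σ i, Fin (b i) × Fin (c i)) → Finset (Fin m))
      (γ : (Σ i, Fin (a i) × Fin (c i)) → Finset (Fin m))
      (F : Finset (Finset (Fin m))),
      (∅ : Finset (Fin m)) ∈ F → (∀ A ∈ F, ∀ B ∈ F, A ∪ B ∈ F) →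
      (∀ x, α x ∈ F) → (∀ y, β y ∈ F) → (∀ z, γ z ∈ F) →
      ∃ (M : Type) (_ : CommMonoid M) (_ : Fintype M)
        (α' : (Σ i, Fin (a i) × Fin (b i)) → M)
        (β' : (Σ i, Fin (b i) × Fin (c i)) → M)
        (γ' : (Σ i, Fin (a i) × Fin (c i)) → M),
        (∀ x : M, x * x = x) ∧ Fintype.card M = F.card ∧
        (∀ x y z, α' x * β' y = γ' z ↔ α x ∪ β y = γ z))) :
    ∀ ε : ℝ, 0 < ε → ∃ (M : Type) (_ : CommMonoid M) (_ : Fintype M), (∀ x : M, x * x = x) ∧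
      ∃ (p : ℕ) (a b c : Fin p → ℕ)
        (α : (Σ i, Fin (a i) × Fin (b i)) → M) (β : (Σ i, Fin (b i) × Fin (c i)) → M)
        (γ : (Σ i, Fin (a i) × Fin (c i)) → M),
        (∀ x y z, α x * β y = γ z ↔
          (z.1 = x.1 ∧ x.1 = y.1 ∧ (z.2.1 : ℕ) = x.2.1 ∧ (x.2.2 : ℕ) = y.2.1 ∧ (z.2.2 : ℕ) = y.2.2)) ∧
        (Fintype.card M : ℝ) < ∑ i, ((a i * b i * c i : ℕ) : ℝ) ^ ((2 + ε) / 3) := by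
  intro ε hε
  obtain ⟨m, p, a, b, c, α, β, γ, F, htpp, h0, hU, hα, hβ, hγ, hcard⟩ := hD ε hε
  obtain ⟨M, instM, instF, α', β', γ', hidem, hcardM, hrel⟩ := hH m p a b c α β γ F h0 hU hα hβ hγ
  refine ⟨M, instM, instF, hidem, p, a, b, c, α', β', γ', fun x y z => (hrel x y z).trans (htpp x y z), ?_⟩
  rw [hcardM]
  exact hcard

/-- The rank-4 crux `IdempotentPacking` BY NAME from the two DECLARED stubs (`closed = false` only through
`stub_*`; the route decl unfolds to the conclusion of `IdempotentPacking_of_sigs` by `rfl`). -/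
theorem IdempotentPacking_of : IdempotentPacking :=
  IdempotentPacking_of_sigs stub_unionClosedDesign stub_hostFromFamily

/-- COMPOSITION, BC3 SHAPE `stub₁-sig → stub₂-sig → crux` with explicit hypotheses (real proof, no `sorry`):
conclusion = the body of the crux `Thesis` VERBATIM (kept unfolded so that the by-name skeleton theorem below
is the unique candidate of `#h21_check_skeleton`, whose layer invariant admits only BY-NAME obligations as
hypotheses).  Host from the family (`hH`), every element regular with witness `y := x` (idempotent:
`x*x*x = x*x = x`), the monoid-TPP iff transported along `α' x * β' y = γ' z ↔ α x ∪ β y = γ z`, and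
`|M| = |F| < Σ_i (a_i b_i c_i)^((2+ε)/3)`. -/
theorem Thesis_of_sigs
    (hD : (∀ ε : ℝ, 0 < ε → ∃ (m p : ℕ) (a b c : Fin p → ℕ)
      (α : (Σ i, Fin (a i) × Fin (b i)) → Finset (Fin m))
      (β : (Σ i, Fin (b i) × Fin (c i)) → Finset (Fin m))
      (γ : (Σ i, Fin (a i) × Fin (c i)) → Finset (Fin m))
      (F : Finset (Finset (Fin m))),
      (∀ x y z, α x ∪ β y = γ z ↔
        (z.1 = x.1 ∧ x.1 = y.1 ∧ (z.2.1 : ℕ) = x.2.1 ∧ (x.2.2 : ℕ) = y.2.1 ∧ (z.2.2 : ℕ) = y.2.2)) ∧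
      (∅ : Finset (Fin m)) ∈ F ∧ (∀ A ∈ F, ∀ B ∈ F, A ∪ B ∈ F) ∧
      (∀ x, α x ∈ F) ∧ (∀ y, β y ∈ F) ∧ (∀ z, γ z ∈ F) ∧
      (F.card : ℝ) < ∑ i, ((a i * b i * c i : ℕ) : ℝ) ^ ((2 + ε) / 3)))
    (hH : (∀ (m p : ℕ) (a b c : Fin p → ℕ)
      (α : (Σ i, Fin (a i) × Fin (b i)) → Finset (Fin m))
      (β : (Σ i, Fin (b i) × Fin (c i)) → Finset (Fin m))
      (γ : (Σ i, Fin (a i) × Fin (c i)) → Finset (Fin m))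
      (F : Finset (Finset (Fin m))),
      (∅ : Finset (Fin m)) ∈ F → (∀ A ∈ F, ∀ B ∈ F, A ∪ B ∈ F) →
      (∀ x, α x ∈ F) → (∀ y, β y ∈ F) → (∀ z, γ z ∈ F) →
      ∃ (M : Type) (_ : CommMonoid M) (_ : Fintype M)
        (α' : (Σ i, Fin (a i) × Fin (b i)) → M)
        (β' : (Σ i, Fin (b i) × Fin (c i)) → M)
        (γ' : (Σ i, Fin (a i) × Fin (c i)) → M),
        (∀ x : M, x * x = x) ∧ Fintype.card M = F.card ∧
        (∀ x y z, α' x * β' y = γ' z ↔ α x ∪ β y = γ z))) :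
    ∀ ε : ℝ, 0 < ε → ∃ (M : Type) (_ : CommMonoid M) (_ : Fintype M), (∀ x : M, ∃ y : M, x * y * x = x) ∧
      ∃ (p : ℕ) (a b c : Fin p → ℕ)
        (α : (Σ i, Fin (a i) × Fin (b i)) → M) (β : (Σ i, Fin (b i) × Fin (c i)) → M)
        (γ : (Σ i, Fin (a i) × Fin (c i)) → M),
        (∀ x y z, α x * β y = γ z ↔
          (z.1 = x.1 ∧ x.1 = y.1 ∧ (z.2.1 : ℕ) = x.2.1 ∧ (x.2.2 : ℕ) = y.2.1 ∧ (z.2.2 : ℕ) = y.2.2)) ∧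
        (Fintype.card M : ℝ) < ∑ i, ((a i * b i * c i : ℕ) : ℝ) ^ ((2 + ε) / 3) := by
  intro ε hε
  obtain ⟨m, p, a, b, c, α, β, γ, F, htpp, h0, hU, hα, hβ, hγ, hcard⟩ := hD ε hε
  obtain ⟨M, instM, instF, α', β', γ', hidem, hcardM, hrel⟩ := hH m p a b c α β γ F h0 hU hα hβ hγ
  refine ⟨M, instM, instF, ?_, p, a, b, c, α', β', γ', fun x y z => (hrel x y z).trans (htpp x y z), ?_⟩
  · intro x
    exact ⟨x, by rw [hidem x, hidem x]⟩
  · rw [hcardM]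
    exact hcard

/-- **THE SKELETON THEOREM.** The crux `Summit.MatrixMultiplication.MatrixMultiplication.Theses.SemilatticeSTPP.Thesis`
(stmt-MatrixMultiplication-5969) concluded BY NAME from the two DECLARED stubs `stub_unionClosedDesign` and
`stub_hostFromFamily` (the only `sorry`s of the file) through the sorry-free composition `Thesis_of_sigs`
(the route decl unfolds to its conclusion by `rfl`); `closed = false` only through `stub_*`. -/
theorem Thesis_of : Thesis :=
  Thesis_of_sigs stub_unionClosedDesign stub_hostFromFamily

end Summit.MatrixMultiplication.MatrixMultiplication.Cruxes.Thesis.BirthSemilatticeSTPP
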